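/-
Origin: expansion seat `planner-pub-hodgecm-pv09-g3-0`, handover #2 2026-08-18T05:29:00Z (`HOME/pub-hodgecm-pv09-g3/lean/Pv09g3/PureTensorCoeff.lean`, md5 47a7634e, 335 lines);
landed by the gen-6 packager in gate run 23 as `HodgeCM/PerL34/PureTensorCoeff.lean` (import ^import Pv[0-9]+g[0-9]+\.→import HodgeCM.PerL34. ×1).
-/
/-
Copyright: HodgeCM publication cell (pub-hodgecm), DAG node N31, seam (I) (prover pv09, generation 3).
Released under the package licence.

# N31 seam (I), second file: the matrix coefficient `y ↦ ⟨φ, ω(y)φ⟩` is a pure tensor as soon as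
# `φ` is FIXED by a box subgroup and the coefficient is MULTIPLICATIVE across coordinates —
# pv11's dictionary hypothesis `hf` reduced to two datum-free identities about `(ω, φ)`

Source under adjudication (NOT cited as a fact; this file PROVES a typed piece of its seam):
PerL v5 = `inputs/2001/summits__hodge-w-picard-modular-quadrilinear-period-galois-
closure__free__y1__paper__paper.tex`, Lemma 4.2(b), proof, tex ll. 608–609, verbatim:

  608: ... $=\int_{\U(W_i)(\A)}\langle\omega(y)\varphi,\varphi\rangle\,\chi'(y)\,dy$.
  609: For $\varphi=\otimes\varphi_v$ the last integral is $\prod_v I_v(\varphi_v)$ ...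

and l. 629–630 (`I_v(φ⁰_v) = 1` at the unramified non-split places, which silently uses that the
unramified vector `φ⁰_v` is `U(W_i)(𝒪_v)`-fixed — GAPS `adv4g7-X5`; that invariance is the
hypothesis `hK` below, now VISIBLE and load-bearing).

## Position in the DAG / what this file does

`PureTensorChar.lean` (this seat, first file) reduced the first binder of pv11's LANDED
`AdelicFactorisation.RestrictedProductMeasureDatum.hEuler_of_pureTensor`,

  `hf : D.IsPureTensor T (fun y => ⟪φ, ω y φ⟫ * χ′ y) fl`        (SETUP D5),

to the factorisation `hc : D.IsPureTensor T (fun y => ⟪φ, ω y φ⟫) cl` of the matrix coefficient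
alone (the `χ′`-half being KERNEL).  `hc` still speaks about the measure datum `D` (its levels
`A_S` and gluing maps `e_S`).  This file removes the datum from the residual hypothesis: for every
datum with coordinate gluing maps (`IsCoordinate`, proved for all four constructed data in the first
file) `hc` FOLLOWS, with the CANONICAL local factors

  `localCoeff B ω φ i g = ⟪φ, ω(ι_i g)φ⟫`   (`ι_i = RestrictedProduct.mulSingle B i`, the inclusion
  of the `i`-th factor — Deitmar, *Automorphic Forms*, §6.3, "embedded via x ↦ (…, 1, x, 1, …)"),

from two identities about the pair `(ω, φ)` that do not mention `D`:

* `hK` : `ω(k)φ = φ` for `k` in the box subgroup `K_T = ∏_{i∉T} B_i × ∏_{i∈T} {1}` (the unramified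
  vector is fixed by the compact open subgroups off `T`), and
* `hM` : on elements supported on a finite `S ⊇ T` the coefficient is the product of its values on
  the coordinates: `⟪φ, ω(extendOne_S y)φ⟫ = ∏_{i∈S} ⟪φ, ω(ι_i y_i)φ⟫` — equivalently
  (`isPureTensor_coeff_of_mulDisjoint`) `‖φ‖ = 1` and `⟪φ, ω(ab)φ⟫ = ⟪φ, ω(a)φ⟫⟪φ, ω(b)φ⟫` whenever
  `a`, `b` have disjoint supports (`a_i = 1 ∨ b_i = 1` for every `i`).

Both are the defining behaviour of a restricted tensor product `ω = ⊗′ω_v` on `φ = ⊗φ⁰_v` with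
unit unramified vectors; they are what remains of SETUP D4/D5 on this seam (the adelic Weil
representation is posited, not constructed, in this package).

* §1 `IsCoordinate.isPureTensor_of_rightInvariant`: the mechanism of the first file's character
  theorem for an ARBITRARY function `F : Πʳ i, [G i, B i] → ℂ` — right-`K_T`-invariance + the
  product formula on `extendOne_S` ⇒ `D.IsPureTensor T F (fun i g => F (ι_i g))`.
* §2 (commutative factors) `extendOne_eq_prod` and `apply_prod_mulSingle_of_mulDisjoint`:
  `F(1) = 1` + multiplicativity on disjointly supported pairs ⇒ the product formula, by induction
  on the support.
* §3 `localCoeff`, `inner_map_mul_of_fixed`, **`IsCoordinate.isPureTensor_coeff`** and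
  **`IsCoordinate.isPureTensor_coeff_of_mulDisjoint`**.
* §4 the seam BY NAME with `hc` discharged: **`hEuler_of_fixedVector`** (pv11's
  `hEuler_of_pureTensor` from `hK`, `hM`, continuity of `χ′`, measurability of the integrand and the
  local `L¹` data / values of `localCoeff`), `hEuler_of_fixedVector_of_continuous` (measurability
  from continuity of the orbit map, first file's `aestronglyMeasurable_coeff_mul_char`), and
  **`rallis_field_of_fixedVector`** (⇒ the `rallis` field of pv13's `LocalFactorDatum` via pv09's
  N31e `RallisIP.rallis_field_of_N31e'`).

RESIDUAL after this file (honest): `hK`, `hM` (or `‖φ‖ = 1` + disjoint multiplicativity), the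
continuity of `y ↦ ω(y)φ` and of `χ′`, and the local `L¹` data / values of the canonical local
coefficients `g ↦ ⟪φ, ω(ι_i g)φ⟫` (pv07/pv13 inputs: under the dictionary `ω ∘ ι_i ≅ ω_i ⊗ id`
these are `⟨ω_i(g)φ⁰_i, φ⁰_i⟩`).  Nothing about the measure datum, the levels, Fubini, the Euler
product or `χ′` remains hypothetical.

No internally-minted statement is cited; no hypothesis of this file names PerL, QW8 or a
2001-programme claim.  Imports: Mathlib + (LANDED/handed) `HodgeCM.PerL34.*` only; axioms = the
standard trio.  Unit `pub-hodgecm-pv09-g3` (DAG-node prover #09, generation 3), 2026-08-18.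
-/
import Summits.HodgeConjecture.HodgeCM.PerL34.PureTensorChar_2

set_option autoImplicit false

noncomputable section

open MeasureTheory Set Filter Function Topology

open scoped RestrictedProduct

namespace HodgeCM.PerL34.PureTensor

open HodgeCM.PerL34.AdelicFactorisation HodgeCM.PerL34.RestrictedMeasure
  HodgeCM.PerL34.NoSmallSubgroups

universe u v

/-! ## §1 Right-invariant functions with the product formula are pure tensors -/

section core

variable {ι : Type u} {G : ι → Type v} [∀ i, Group (G i)] [DecidableEq ι]
  {Sub : ι → Type*} [∀ i, SetLike (Sub i) (G i)] [∀ i, SubgroupClass (Sub i) (G i)]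
  (B : ∀ i, Sub i) [∀ i, MeasurableSpace (G i)]

/-- **The mechanism.**  Let `D` be a restricted product measure datum over `Πʳ i, [G i, B i]` with
coordinate gluing maps and `F : Πʳ i, [G i, B i] → ℂ` any function which is
(`hK`) right-invariant under the box subgroup `K_T` and (`hM`) satisfies the product formula
`F(extendOne_S y) = ∏_{i∈S} F(ι_i y_i)` on every finite level `S ⊇ T`.  Then `F = ⊗_i (F ∘ ι_i)`
in the sense of pv11's `IsPureTensor` (on `A_S`, `F ∘ e_S` is the product of the local factors). -/
theorem IsCoordinate.isPureTensor_of_rightInvariant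
    {D : RestrictedProductMeasureDatum ι G (Πʳ i, [G i, B i])} (hD : IsCoordinate D)
    (F : (Πʳ i, [G i, B i]) → ℂ) {T : Finset ι}
    (hK : ∀ y, ∀ k ∈ RestrictedProduct.boxSubgroup B T, F (y * k) = F y)
    (hM : ∀ S : Finset ι, T ⊆ S → ∀ y : (i : ↥S) → G i,
      F (extendOne B S y) = ∏ i : ↥S, F (RestrictedProduct.mulSingle B (i : ι) (y i))) :
    D.IsPureTensor T F (fun i g => F (RestrictedProduct.mulSingle B i g)) := by
  intro S hTS x
  have hk : (extendOne B S x.1)⁻¹ * D.e S x ∈ RestrictedProduct.boxSubgroup B T :=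
    boxSubgroup_antitone B hTS (extendOne_inv_mul_mem_boxSubgroup B S x.1 (D.e S x)
      (fun _ hi => hD.apply_of_mem S x hi) (fun _ hi => hD.apply_of_not_mem S x hi))
  calc F (D.e S x) = F (extendOne B S x.1 * ((extendOne B S x.1)⁻¹ * D.e S x)) := by
        rw [mul_inv_cancel_left]
    _ = F (extendOne B S x.1) := hK _ _ hk
    _ = ∏ i : ↥S, F (RestrictedProduct.mulSingle B (i : ι) (x.1 i)) := hM S hTS x.1

end core

/-! ## §2 Commutative factors: the product formula from multiplicativity on disjoint supports -/

section disjoint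

variable {ι : Type u} {G : ι → Type v} [∀ i, CommGroup (G i)] [DecidableEq ι]
  {Sub : ι → Type*} [∀ i, SetLike (Sub i) (G i)] [∀ i, SubgroupClass (Sub i) (G i)]
  (B : ∀ i, Sub i)

/-- For commutative factors, `extendOne_S y` is the (finite) product of the basic elements
`ι_i (y_i)`, `i ∈ S`. -/
theorem extendOne_eq_prod (S : Finset ι) (y : (i : ↥S) → G i) :
    extendOne B S y = ∏ i : ↥S, RestrictedProduct.mulSingle B (i : ι) (y i) := by
  rw [map_eq_prod_map_mulSingle (extendOne B S) y]
  exact Finset.prod_congr rfl fun i _ => extendOne_mulSingle B S i (y i)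

/-- The coordinates of a finite product of basic elements at distinct indices. -/
theorem prod_mulSingle_apply (S : Finset ι) (y : (i : ↥S) → G i) (s : Finset ↥S) (i : ι) :
    (∏ k ∈ s, RestrictedProduct.mulSingle B (k : ι) (y k)) i =
      ∏ k ∈ s, (RestrictedProduct.mulSingle B (k : ι) (y k)) i := by
  simpa only [RestrictedProduct.evalMonoidHom_apply] using
    map_prod (RestrictedProduct.evalMonoidHom G i)
      (fun k : ↥S => RestrictedProduct.mulSingle B (k : ι) (y k)) s

/-- **Multiplicativity on disjointly supported pairs gives the product formula.**  If `F 1 = 1`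
and `F (a * b) = F a * F b` whenever `a`, `b` have disjoint supports (`a_i = 1 ∨ b_i = 1` for all
`i`), then `F (∏_{i∈S} ι_i y_i) = ∏_{i∈S} F (ι_i y_i)` (induction on the support). -/
theorem apply_prod_mulSingle_of_mulDisjoint {M : Type*} [CommMonoid M]
    (F : (Πʳ i, [G i, B i]) → M) (h1 : F 1 = 1)
    (h2 : ∀ a b : Πʳ i, [G i, B i], (∀ i, a i = 1 ∨ b i = 1) → F (a * b) = F a * F b)
    (S : Finset ι) (y : (i : ↥S) → G i) (s : Finset ↥S) :
    F (∏ k ∈ s, RestrictedProduct.mulSingle B (k : ι) (y k)) =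
      ∏ k ∈ s, F (RestrictedProduct.mulSingle B (k : ι) (y k)) := by
  induction s using Finset.induction_on with
  | empty => simpa using h1
  | insert j s hj ih =>
    rw [Finset.prod_insert hj, Finset.prod_insert hj, h2 _ _ fun i => ?_, ih]
    by_cases hij : i = (j : ι)
    · refine Or.inr ?_
      rw [prod_mulSingle_apply B S y s i]
      refine Finset.prod_eq_one fun k hk => ?_
      subst hij
      exact RestrictedProduct.mulSingle_eq_of_ne B (y k) fun h : (j : ι) = (k : ι) =>
        hj (by rwa [Subtype.ext h])
    · exact Or.inl (RestrictedProduct.mulSingle_eq_of_ne B (y j) hij)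

/-- The product formula on `extendOne_S` from `F 1 = 1` and disjoint multiplicativity. -/
theorem apply_extendOne_of_mulDisjoint {M : Type*} [CommMonoid M]
    (F : (Πʳ i, [G i, B i]) → M) (h1 : F 1 = 1)
    (h2 : ∀ a b : Πʳ i, [G i, B i], (∀ i, a i = 1 ∨ b i = 1) → F (a * b) = F a * F b)
    (S : Finset ι) (y : (i : ↥S) → G i) :
    F (extendOne B S y) = ∏ i : ↥S, F (RestrictedProduct.mulSingle B (i : ι) (y i)) := by
  rw [extendOne_eq_prod]
  exact apply_prod_mulSingle_of_mulDisjoint B F h1 h2 S y Finset.univ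

end disjoint

/-! ## §3 Matrix coefficients of a vector fixed by a box subgroup -/

section coeff

variable {ι : Type u} {G : ι → Type v} [∀ i, Group (G i)] [DecidableEq ι]
  {Sub : ι → Type*} [∀ i, SetLike (Sub i) (G i)] [∀ i, SubgroupClass (Sub i) (G i)]
  (B : ∀ i, Sub i) {Sp : Type*} [NormedAddCommGroup Sp] [InnerProductSpace ℂ Sp]

/-- The CANONICAL local coefficient at `i` of the pair `(ω, φ)`: `g ↦ ⟪φ, ω(ι_i g)φ⟫`, `ι_i` the
inclusion of the `i`-th factor (`RestrictedProduct.mulSingle B i`).  Under the dictionary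
`ω ∘ ι_i ≅ ω_i ⊗ id`, `φ = φ_i ⊗ φ^i` with `‖φ^i‖ = 1`, it is `⟨ω_i(g)φ_i, φ_i⟩` (up to the
conjugation convention of `inner`). -/
def localCoeff (ω : (Πʳ i, [G i, B i]) →* (Sp ≃ₗᵢ[ℂ] Sp)) (φ : Sp) (i : ι) (g : G i) : ℂ :=
  inner ℂ φ (ω (RestrictedProduct.mulSingle B i g) φ)

omit [DecidableEq ι] in
/-- A vector fixed by `ω(k)` has right-`k`-invariant diagonal matrix coefficient. -/
theorem inner_map_mul_of_fixed (ω : (Πʳ i, [G i, B i]) →* (Sp ≃ₗᵢ[ℂ] Sp)) (φ : Sp)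
    {k : Πʳ i, [G i, B i]} (hk : ω k φ = φ) (y : Πʳ i, [G i, B i]) :
    inner ℂ φ (ω (y * k) φ) = inner ℂ φ (ω y φ) := by
  rw [map_mul, LinearIsometryEquiv.coe_mul, Function.comp_apply, hk]

omit [DecidableEq ι] in
/-- The diagonal matrix coefficient at `1` is `‖φ‖²`; for a unit vector it is `1`. -/
theorem inner_map_one_of_norm_eq_one (ω : (Πʳ i, [G i, B i]) →* (Sp ≃ₗᵢ[ℂ] Sp)) {φ : Sp}
    (hφ : ‖φ‖ = 1) : inner ℂ φ (ω 1 φ) = 1 := by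
  rw [map_one, LinearIsometryEquiv.coe_one, id, inner_self_eq_norm_sq_to_K, hφ]
  simp

variable [∀ i, MeasurableSpace (G i)]

/-- **The matrix coefficient of a `K_T`-fixed vector with the product formula is a pure tensor**,
with the canonical local coefficients as local factors. -/
theorem IsCoordinate.isPureTensor_coeff
    {D : RestrictedProductMeasureDatum ι G (Πʳ i, [G i, B i])} (hD : IsCoordinate D)
    (ω : (Πʳ i, [G i, B i]) →* (Sp ≃ₗᵢ[ℂ] Sp)) (φ : Sp) {T : Finset ι}
    (hK : ∀ k ∈ RestrictedProduct.boxSubgroup B T, ω k φ = φ)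
    (hM : ∀ S : Finset ι, T ⊆ S → ∀ y : (i : ↥S) → G i,
      inner ℂ φ (ω (extendOne B S y) φ) = ∏ i : ↥S, localCoeff B ω φ i (y i)) :
    D.IsPureTensor T (fun y => inner ℂ φ (ω y φ)) (localCoeff B ω φ) :=
  hD.isPureTensor_of_rightInvariant B (fun y => inner ℂ φ (ω y φ))
    (fun y k hk => inner_map_mul_of_fixed B ω φ (hK k hk) y) hM

end coeff

section coeffComm

variable {ι : Type u} {G : ι → Type v} [∀ i, CommGroup (G i)] [DecidableEq ι]
  {Sub : ι → Type*} [∀ i, SetLike (Sub i) (G i)] [∀ i, SubgroupClass (Sub i) (G i)]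
  (B : ∀ i, Sub i) {Sp : Type*} [NormedAddCommGroup Sp] [InnerProductSpace ℂ Sp]
  [∀ i, MeasurableSpace (G i)]

/-- **Commutative factors**: a UNIT vector fixed by `K_T` whose diagonal matrix coefficient is
multiplicative on disjointly supported pairs has pure-tensor matrix coefficient, with the
canonical local coefficients as local factors. -/
theorem IsCoordinate.isPureTensor_coeff_of_mulDisjoint
    {D : RestrictedProductMeasureDatum ι G (Πʳ i, [G i, B i])} (hD : IsCoordinate D)
    (ω : (Πʳ i, [G i, B i]) →* (Sp ≃ₗᵢ[ℂ] Sp)) {φ : Sp} (hφ : ‖φ‖ = 1) {T : Finset ι}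
    (hK : ∀ k ∈ RestrictedProduct.boxSubgroup B T, ω k φ = φ)
    (h2 : ∀ a b : Πʳ i, [G i, B i], (∀ i, a i = 1 ∨ b i = 1) →
      inner ℂ φ (ω (a * b) φ) = inner ℂ φ (ω a φ) * inner ℂ φ (ω b φ)) :
    D.IsPureTensor T (fun y => inner ℂ φ (ω y φ)) (localCoeff B ω φ) :=
  hD.isPureTensor_coeff B ω φ hK fun S _ y =>
    apply_extendOne_of_mulDisjoint B (fun y => inner ℂ φ (ω y φ))
      (inner_map_one_of_norm_eq_one B ω hφ) h2 S y

end coeffComm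

/-! ## §4 The N31 seam with `hc` discharged: `hEuler` / `rallis` from a fixed vector -/

section N31

variable {ι : Type u} {G : ι → Type v} [∀ i, CommGroup (G i)] [∀ i, MeasurableSpace (G i)]
  [∀ i, TopologicalSpace (G i)]
  {Sub : ι → Type*} [∀ i, SetLike (Sub i) (G i)] [∀ i, SubgroupClass (Sub i) (G i)]
  (B : ∀ i, Sub i) [Countable ι] [DecidableEq ι]
  {Sp E : Type*} [NormedAddCommGroup Sp] [InnerProductSpace ℂ Sp]
  [NormedAddCommGroup E] [InnerProductSpace ℂ E]

open scoped InnerProductSpace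
open ComplexConjugate

/-- **Seam (I) BY NAME, `hf` discharged down to `(hK, hM)`.**  pv11's `hEuler_of_pureTensor`
(`∫_{U(W_i)(𝔸)} ⟨ω(y)φ,φ⟩χ′(y)dy = ∏_v I_v`, PerL v5 ll. 608–609) for a datum with coordinate gluing
maps over `Πʳ i, [G i, B i]` (`B i` open), a continuous unitary character `χ′`, and a vector `φ`
FIXED by the box subgroup `K_T` (`hK`) whose diagonal matrix coefficient satisfies the product
formula on the finite levels (`hM`); the local factors are the canonical local coefficients times
the local components of `χ′`. -/
theorem hEuler_of_fixedVector [∀ i, OpensMeasurableSpace (G i)]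
    (hBopen : ∀ i, IsOpen (B i : Set (G i)))
    (D : RestrictedProductMeasureDatum ι G (Πʳ i, [G i, B i])) (hD : IsCoordinate D)
    (ω : (Πʳ i, [G i, B i]) →* (Sp ≃ₗᵢ[ℂ] Sp)) (φ : Sp)
    (χ : (Πʳ i, [G i, B i]) →* Circle) (hχ : Continuous χ) {T : Finset ι}
    (hK : ∀ k ∈ RestrictedProduct.boxSubgroup B T, ω k φ = φ)
    (hM : ∀ S : Finset ι, T ⊆ S → ∀ y : (i : ↥S) → G i,
      inner ℂ φ (ω (extendOne B S y) φ) = ∏ i : ↥S, localCoeff B ω φ i (y i))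
    (hfm : AEStronglyMeasurable (fun y => inner ℂ φ (ω y φ) * ((χ y : Circle) : ℂ)) D.μ)
    (hcl : ∀ i, Integrable (localCoeff B ω φ i) (D.ν i))
    (hB : ∃ C : ℝ, ∀ S : Finset ι, D.S₀ ⊆ S → T ⊆ S →
      ∏ i ∈ S, ∫ x, ‖localCoeff B ω φ i x‖ ∂D.ν i ≤ C)
    {I : ι → ℝ} (hI : ∀ i, ∫ x, localCoeff B ω φ i x *
      ((χ (RestrictedProduct.mulSingle B i x) : Circle) : ℂ) ∂D.ν i = (I i : ℂ)) :
    ∫ y, inner ℂ φ (ω y φ) * ((χ y : Circle) : ℂ) ∂D.μ = ((∏' i, I i : ℝ) : ℂ) :=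
  hEuler_of_coeffTensor_of_continuous B hBopen D hD ω φ χ hχ (hD.isPureTensor_coeff B ω φ hK hM)
    hfm hcl hB hI

/-- `hEuler_of_fixedVector` with the measurability of the integrand supplied by continuity of the
orbit map `y ↦ ω(y)φ` (second-countable Borel factors; first file's
`aestronglyMeasurable_coeff_mul_char`): the remaining hypotheses are `hK`, `hM`, two continuity
statements and the local `L¹` data / values. -/
theorem hEuler_of_fixedVector_of_continuous [∀ i, BorelSpace (G i)]
    [∀ i, SecondCountableTopology (G i)] (hBopen : ∀ i, IsOpen (B i : Set (G i)))
    (D : RestrictedProductMeasureDatum ι G (Πʳ i, [G i, B i])) (hD : IsCoordinate D)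
    (ω : (Πʳ i, [G i, B i]) →* (Sp ≃ₗᵢ[ℂ] Sp)) (φ : Sp) (hω : Continuous fun y => ω y φ)
    (χ : (Πʳ i, [G i, B i]) →* Circle) (hχ : Continuous χ) {T : Finset ι}
    (hK : ∀ k ∈ RestrictedProduct.boxSubgroup B T, ω k φ = φ)
    (hM : ∀ S : Finset ι, T ⊆ S → ∀ y : (i : ↥S) → G i,
      inner ℂ φ (ω (extendOne B S y) φ) = ∏ i : ↥S, localCoeff B ω φ i (y i))
    (hcl : ∀ i, Integrable (localCoeff B ω φ i) (D.ν i))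
    (hB : ∃ C : ℝ, ∀ S : Finset ι, D.S₀ ⊆ S → T ⊆ S →
      ∏ i ∈ S, ∫ x, ‖localCoeff B ω φ i x‖ ∂D.ν i ≤ C)
    {I : ι → ℝ} (hI : ∀ i, ∫ x, localCoeff B ω φ i x *
      ((χ (RestrictedProduct.mulSingle B i x) : Circle) : ℂ) ∂D.ν i = (I i : ℂ)) :
    ∫ y, inner ℂ φ (ω y φ) * ((χ y : Circle) : ℂ) ∂D.μ = ((∏' i, I i : ℝ) : ℂ) :=
  hEuler_of_fixedVector B hBopen D hD ω φ χ hχ hK hM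
    (aestronglyMeasurable_coeff_mul_char B (fun i => (hBopen i).measurableSet) D.μ ω φ hω χ hχ)
    hcl hB hI

/-- **N31e + seam (I) with `hf` discharged down to `(hK, hM)` ⇒ the `rallis` field of pv13's
`LocalFactorDatum`** (`re ⟪θ, θ⟫ = c · vol · ∏' I`), via pv09's N31e `rallis_field_of_N31e'`. -/
theorem rallis_field_of_fixedVector [∀ i, OpensMeasurableSpace (G i)]
    (hBopen : ∀ i, IsOpen (B i : Set (G i)))
    (D : RestrictedProductMeasureDatum ι G (Πʳ i, [G i, B i])) (hD : IsCoordinate D)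
    (ω : (Πʳ i, [G i, B i]) →* (Sp ≃ₗᵢ[ℂ] Sp)) (φ : Sp)
    (χ : (Πʳ i, [G i, B i]) →* Circle) (hχ : Continuous χ) {𝓕 : Set (Πʳ i, [G i, B i])}
    {K : (Πʳ i, [G i, B i]) → (Πʳ i, [G i, B i]) → ℂ} {c vol : ℝ} {θ : E}
    (hvol : vol = (D.μ 𝓕).toReal)
    (hN31e : RallisIP.N31e_statement D.μ 𝓕 ω φ (fun y => ((χ y : Circle) : ℂ)) K (c : ℂ))
    (hnorm : ⟪θ, θ⟫_ℂ = ∫ u in 𝓕, ∫ u' in 𝓕, ((χ u : Circle) : ℂ) * conj ((χ u' : Circle) : ℂ) *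
      K u u' ∂D.μ ∂D.μ)
    {T : Finset ι} (hK : ∀ k ∈ RestrictedProduct.boxSubgroup B T, ω k φ = φ)
    (hM : ∀ S : Finset ι, T ⊆ S → ∀ y : (i : ↥S) → G i,
      inner ℂ φ (ω (extendOne B S y) φ) = ∏ i : ↥S, localCoeff B ω φ i (y i))
    (hfm : AEStronglyMeasurable (fun y => inner ℂ φ (ω y φ) * ((χ y : Circle) : ℂ)) D.μ)
    (hcl : ∀ i, Integrable (localCoeff B ω φ i) (D.ν i))
    (hB : ∃ C : ℝ, ∀ S : Finset ι, D.S₀ ⊆ S → T ⊆ S →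
      ∏ i ∈ S, ∫ x, ‖localCoeff B ω φ i x‖ ∂D.ν i ≤ C)
    {I : ι → ℝ} (hI : ∀ i, ∫ x, localCoeff B ω φ i x *
      ((χ (RestrictedProduct.mulSingle B i x) : Circle) : ℂ) ∂D.ν i = (I i : ℂ)) :
    RCLike.re ⟪θ, θ⟫_ℂ = c * vol * ∏' i, I i :=
  RallisIP.rallis_field_of_N31e' hvol hN31e hnorm
    (hEuler_of_fixedVector B hBopen D hD ω φ χ hχ hK hM hfm hcl hB hI)

end N31

end HodgeCM.PerL34.PureTensor

end
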